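import Summits.Ventures.AbcSig.Rows.XTemplateHalves
import Summits.Ventures.AbcSig.Levels.N8672

/-!
# Venture AbcSig — PARITY-HALF ROW `C2aL271A3yodd`: `xⁿ + 8·271^m·yⁿ = z²`, `y` odd (class `a = 3`, clean level only) over the NORM-FORM level file 8672 = 32·271 (GENERATED by p-lean g4 `gen4/halfrow.py`)

HONEST FRAMING. A row of a COMPUTATION cell (`pub-abcsig`); a CONDITIONAL theorem, no claim on ABC or any summit.
Hypotheses: `BS04Package` (CITED: [BS04] Lemma 3.3 + (3.1) + Lemma 4.2); `DataComplete 8672` + `RefinesCPSymAll 8672` (COMPUTED: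
certified engine-1 level file; norm-form certificates `Sieve/CharpolyCert.lean`, prime-ideal trees where the norm form is weaker);
the listed per-orbit exclusions `hX_…` (CITED: the row of record's module closures — nothing of them is checked here).
Only the parity half living at the single level 32·271 is claimed (the complementary half needs level 2·271, not certified).
Exponent range: prime `n ≥ 11`, `n ≠ 271`, n ∉ [11]; `1 ≤ m < n`.
Residual of record R = {11} (8672.7/.8 at n = 11: M4 leaves classes) EXCLUDED in the statement (hres); CITED: 8672.7/.8 at n = 17 (M4 Kraus / M6c-old, per the row's R3); the degree-28 pair 8672.5/.6 at 13 and 17 killed IN THE KERNEL (prime-ideal trees, θ = c_5 presentation).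
Row of record: `census/rows/C2a/C2a-l271-a3-yodd.md` (sha16 `72f9aef183a7b60d`; R8-signed 2026-08-22T16:05:08Z by referee (ref-g11); PARITY-HALF row (RULING F14)).
-/

namespace Summit.Ventures.AbcSig

/-- Parity-half row `C2aL271A3yodd` (`xⁿ + 8·271^m·yⁿ = z²`, `y` odd (class `a = 3`, clean level only)); prime `n ≥ 11`, `n ≠ 271`, `n ∉ [11]`; conditional on the named hypotheses. -/
theorem xrow_C2aL271A3yodd (M : NewformModel) (hP : M.BS04Package)
    (hD8672 : M.DataComplete 8672 level8672Orbits) (hCP8672 : M.RefinesCPSymAll 8672 level8672CP)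
    (n : ℕ) (hn : n.Prime) (hmin : 11 ≤ n) (hnℓ : n ≠ 271) (hres : n ∉ ([11] : List ℕ)) (m : ℕ) (hm : 1 ≤ m) (hmn : m < n)
    (hX_orbit_8672_7 : n ∈ ([17] : List ℕ) → M.Excludes 8672 orbit_8672_7
      (famB (2 ^ 3 * 271 ^ m) n (fun _ _ => True)))
    (hX_orbit_8672_8 : n ∈ ([17] : List ℕ) → M.Excludes 8672 orbit_8672_8
      (famB (2 ^ 3 * 271 ^ m) n (fun _ _ => True)))
    (x y z : ℤ) (hy : ¬ 2 ∣ y) (hxy1 : x * y ≠ 1) (hxy2 : x * y ≠ -1) : ¬ IsPrimitiveSolution 1 (2 ^ 3 * 271 ^ m) 1 n x y z := by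
  have hℓ : Nat.Prime 271 := by norm_num
  have h7 : 7 ≤ n := by omega
  exact xrowC2a_a3_yodd 271 hℓ (by norm_num) M hP n hn h7 hnℓ hD8672 m hm hmn
    (level8672_sieve M hP hCP8672 n hn h7 (fun o => M.Excludes 8672 o
      (famB (2 ^ 3 * 271 ^ m) n (fun _ _ => True)) ∨ M.ExcludesStd 8672 o n) (fun _ h => Or.inr h) (fun hmem => by
      obtain rfl : n = 7 := by simpa using hmem
      omega) (fun hmem => by
      obtain rfl : n = 7 := by simpa using hmem
      omega) (fun hmem => by
      obtain rfl : n = 7 := by simpa using hmem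
      omega) (fun hmem => by
      obtain rfl : n = 7 := by simpa using hmem
      omega) (fun hmem => by
      rcases (by simpa using hmem : n = 7 ∨ n = 11 ∨ n = 17) with rfl | rfl | rfl
      · omega
      · exact absurd (by simp) hres
      · exact Or.inl (hX_orbit_8672_7 (by simp))) (fun hmem => by
      rcases (by simpa using hmem : n = 7 ∨ n = 11 ∨ n = 17) with rfl | rfl | rfl
      · omega
      · exact absurd (by simp) hres
      · exact Or.inl (hX_orbit_8672_8 (by simp))))
    x y z hy hxy1 hxy2

end Summit.Ventures.AbcSig
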